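import Mathlib
import Summits.Ventures.PercRepro2.TwoSumCap2Ident
import Summits.Ventures.PercRepro2.TwoSumAbsorb

/-!
# The pinned STEP family is closed under the 2-sum with a piece of packing number ≤ 2, given the
capacity-2 rows (M1-STEP), (M2-STEP) of the base
(seat mine-b, cell pub-perc-repro2; conjectures/MINE-B.md §13.3)

The composite count of a 2-sum with a packing-2 piece is `Σ w(a,b)·capH a b` (TwoSumCap2Count.lean),
the capacitated counts are genuine pattern counts of the doubled base (TwoSumCap2Ident.lean), the
weights are colour-swap symmetric (`wt_symm`) and satisfy the piece's pattern Reimer inequality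
`w(2,0) ≤ w(1,1) + w(1,2)` (`wt_reimer`, from `absH_zero_two_le`), and the absorption lemma
(TwoSumAbsorb.lean) gives the **closure theorem** `absH_twoSum₂_le`: pinned STEP at a row `(i,j)`
for every pattern of the doubled base, together with the two capacity-2 slack relations
  (M1-STEP) `slack(D) ≥ slack(C)`  and  (M2-STEP) `slack(D) + slack(E) ≥ 2·slack(C)`
at the pattern (`D` = both copies split, `C` = one copy pinned, `E` = one pinned and one split),
implies pinned STEP at `(i,j)` for the 2-sum with ANY piece of packing number ≤ 2, on every pattern
not containing the pair.  The rows are the seat's conjectures (M1-STEP), (M2-STEP), census-true on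
every binary port on ≤ 9 elements with a parallel pair and on every clutter on 5 elements.
-/

open Finset

namespace Summit.Ventures.PercRepro2

namespace StepZero

open ReimerCube

variable {E₁ E₂ : Type*} [DecidableEq E₁]

section Closure

variable [DecidableEq E₂] {A₁ : Finset E₁ → Prop} {A₂ : Finset E₂ → Prop} {p₁ p₂ : E₁}

open Classical

/-- the weights are colour-swap symmetric -/
lemma wt_symm (A₂ : Finset E₂ → Prop) (O₂ Y₂ : Finset E₂) (a b : ℕ) :
    wt A₂ O₂ Y₂ a b = wt A₂ O₂ Y₂ b a := by
  unfold wt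
  refine Finset.card_bij' (fun γ₂ _ => Y₂ \ γ₂) (fun γ₂ _ => Y₂ \ γ₂) ?_ ?_ ?_ ?_
  · intro γ₂ hγ₂
    rw [Finset.mem_filter, Finset.mem_powerset] at hγ₂ ⊢
    refine ⟨Finset.sdiff_subset, ?_, hγ₂.2.1⟩
    rw [Finset.sdiff_sdiff_eq_self hγ₂.1]; exact hγ₂.2.2
  · intro γ₂ hγ₂
    rw [Finset.mem_filter, Finset.mem_powerset] at hγ₂ ⊢
    refine ⟨Finset.sdiff_subset, ?_, hγ₂.2.1⟩
    rw [Finset.sdiff_sdiff_eq_self hγ₂.1]; exact hγ₂.2.2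
  · intro γ₂ hγ₂
    rw [Finset.mem_filter, Finset.mem_powerset] at hγ₂
    exact Finset.sdiff_sdiff_eq_self hγ₂.1
  · intro γ₂ hγ₂
    rw [Finset.mem_filter, Finset.mem_powerset] at hγ₂
    exact Finset.sdiff_sdiff_eq_self hγ₂.1

omit [DecidableEq E₁] [DecidableEq E₂] in
/-- `A₂` holds wherever it occurs twice disjointly -/
lemma A₂_of_dOcc {R : Finset E₂} (h : DOcc A₂ A₂ R) : A₂ R := by
  obtain ⟨K, -, hK, -, -, hAK, -⟩ := h
  exact hAK _ hK

omit [DecidableEq E₁] in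
omit [DecidableEq E₁] [DecidableEq E₂] in
/-- two disjoint witnesses, for increasing `A₂` -/
lemma kDisj_two_iff (hA₂ : Incr A₂) (S : Finset E₂) : kDisj A₂ 2 S ↔ DOcc A₂ A₂ S := by
  show DOcc A₂ (kDisj A₂ 1) S ↔ DOcc A₂ A₂ S
  constructor
  · exact DOcc.mono_right (fun T hT => (kDisj_one_iff hA₂ T).mp hT)
  · exact DOcc.mono_right (fun T hT => (kDisj_one_iff hA₂ T).mpr hT)

omit [DecidableEq E₁] in
omit [DecidableEq E₁] [DecidableEq E₂] in
/-- the level is `0` iff `A₂` fails -/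
lemma lv_eq_zero_iff (R : Finset E₂) : lv A₂ R = 0 ↔ ¬ A₂ R := by
  unfold lv
  by_cases h2 : DOcc A₂ A₂ R
  · simp [h2, A₂_of_dOcc h2]
  · by_cases h1 : A₂ R <;> simp [h1, h2]

omit [DecidableEq E₁] in
omit [DecidableEq E₁] [DecidableEq E₂] in
/-- the level is `1` iff `A₂` holds but does not occur twice disjointly -/
lemma lv_eq_one_iff (R : Finset E₂) : lv A₂ R = 1 ↔ (A₂ R ∧ ¬ DOcc A₂ A₂ R) := by
  unfold lv
  by_cases h2 : DOcc A₂ A₂ R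
  · simp [h2]
  · by_cases h1 : A₂ R <;> simp [h1, h2]

omit [DecidableEq E₁] in
omit [DecidableEq E₁] [DecidableEq E₂] in
/-- the level is `2` iff `A₂` occurs twice disjointly -/
lemma lv_eq_two_iff (R : Finset E₂) : lv A₂ R = 2 ↔ DOcc A₂ A₂ R := by
  unfold lv
  by_cases h2 : DOcc A₂ A₂ R
  · simp [h2]
  · by_cases h1 : A₂ R <;> simp [h1, h2]

omit [DecidableEq E₁] in
omit [DecidableEq E₁] in
/-- **the piece's pattern Reimer inequality in the weights**: `w(2,0) ≤ w(1,1) + w(1,2)`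
(`absH_zero_two_le` for the piece) -/
lemma wt_reimer (hA₂ : Incr A₂) (O₂ Y₂ : Finset E₂) :
    wt A₂ O₂ Y₂ 2 0 ≤ wt A₂ O₂ Y₂ 1 1 + wt A₂ O₂ Y₂ 1 2 := by
  have h := absH_zero_two_le hA₂ O₂ Y₂
  have e1 : absH A₂ O₂ Y₂ 0 2 = wt A₂ O₂ Y₂ 0 2 := by
    unfold absH wt pinK
    congr 1
    ext γ₂
    rw [Finset.mem_filter, Finset.mem_filter]
    apply and_congr_right
    intro _
    rw [kDisj_one_iff hA₂, kDisj_two_iff hA₂, lv_eq_zero_iff, lv_eq_two_iff]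
    simp only [kDisj, true_and]
  have e2 : absH A₂ O₂ Y₂ 1 1 = wt A₂ O₂ Y₂ 1 1 + wt A₂ O₂ Y₂ 1 2 := by
    unfold absH wt pinK
    rw [← Finset.card_union_of_disjoint]
    · congr 1
      ext γ₂
      rw [Finset.mem_union, Finset.mem_filter, Finset.mem_filter, Finset.mem_filter, ← and_or_left]
      apply and_congr_right
      intro _
      rw [kDisj_one_iff hA₂, kDisj_two_iff hA₂, kDisj_one_iff hA₂, lv_eq_one_iff, lv_eq_one_iff,
        lv_eq_two_iff]
      constructor
      · rintro ⟨h1, h2, h3⟩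
        by_cases h4 : DOcc A₂ A₂ (O₂ ∪ γ₂)
        · exact Or.inr ⟨⟨h1, h2⟩, h4⟩
        · exact Or.inl ⟨⟨h1, h2⟩, h3, h4⟩
      · rintro (⟨⟨h1, h2⟩, h3, -⟩ | ⟨⟨h1, h2⟩, h4⟩)
        · exact ⟨h1, h2, h3⟩
        · exact ⟨h1, h2, A₂_of_dOcc h4⟩
    · rw [Finset.disjoint_left]
      intro γ₂ h1 h2
      rw [Finset.mem_filter] at h1 h2
      have := h1.2.2.symm.trans h2.2.2
      omega
  rw [e1, wt_symm A₂ O₂ Y₂ 0 2] at h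
  rw [e2] at h
  exact h

/-- **Pinned STEP is closed under the 2-sum with a piece of packing number ≤ 2, given the
capacity-2 rows.**  Let the base `A₁` have a parallel pair `p₁, p₂`, the piece `A₂` packing number
≤ 2, and `(O, Y)` a pattern of `E₁ ⊕ E₂` avoiding the pair, with left parts `O₁, Y₁`.  If the base
satisfies STEP at the row `(i,j)` on every pattern, and at `(O₁, Y₁)` the slack relations
(M1-STEP) `slack(D) ≥ slack(C)` and (M2-STEP) `slack(D) + slack(E) ≥ 2·slack(C)` hold — `D` the
pattern with both copies split, `C` with one copy pinned, `E` with one pinned and one split — then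
the 2-sum satisfies STEP at `(i,j)` on `(O, Y)`. -/
theorem absH_twoSum₂_le (hpar : IsParallel A₁ p₁ p₂) (hA₁ : Incr A₁) (hA₂ : Incr A₂)
    (h₂ : ∀ S, ¬ DOcc A₂ (DOcc A₂ A₂) S) (O Y : Finset (E₁ ⊕ E₂)) (hp1 : Sum.inl p₁ ∉ O ∪ Y)
    (hp2 : Sum.inl p₂ ∉ O ∪ Y) (i j : ℕ)
    (hbase : ∀ O' Y' : Finset E₁, absH A₁ O' Y' i j ≤ absH A₁ O' Y' (i + 1) (j - 1))
    (hM₁ : absH A₁ O.toLeft (insert p₁ (insert p₂ Y.toLeft)) i j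
        + absH A₁ (insert p₁ O.toLeft) Y.toLeft (i + 1) (j - 1)
      ≤ absH A₁ O.toLeft (insert p₁ (insert p₂ Y.toLeft)) (i + 1) (j - 1)
        + absH A₁ (insert p₁ O.toLeft) Y.toLeft i j)
    (hM₂ : absH A₁ O.toLeft (insert p₁ (insert p₂ Y.toLeft)) i j
        + absH A₁ (insert p₁ O.toLeft) (insert p₂ Y.toLeft) i j
        + 2 * absH A₁ (insert p₁ O.toLeft) Y.toLeft (i + 1) (j - 1)
      ≤ absH A₁ O.toLeft (insert p₁ (insert p₂ Y.toLeft)) (i + 1) (j - 1)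
        + absH A₁ (insert p₁ O.toLeft) (insert p₂ Y.toLeft) (i + 1) (j - 1)
        + 2 * absH A₁ (insert p₁ O.toLeft) Y.toLeft i j) :
    absH (twoSum (del A₁ p₂) A₂ p₁) O Y i j ≤ absH (twoSum (del A₁ p₂) A₂ p₁) O Y (i + 1) (j - 1) := by
  have hO1 : p₁ ∉ O.toLeft := fun h => hp1 (Finset.mem_union_left _ (Finset.mem_toLeft.mp h))
  have hO2 : p₂ ∉ O.toLeft := fun h => hp2 (Finset.mem_union_left _ (Finset.mem_toLeft.mp h))
  have hY1 : p₁ ∉ Y.toLeft := fun h => hp1 (Finset.mem_union_right _ (Finset.mem_toLeft.mp h))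
  have hY2 : p₂ ∉ Y.toLeft := fun h => hp2 (Finset.mem_union_right _ (Finset.mem_toLeft.mp h))
  rw [absH_twoSum₂_eq_sum hpar hA₁ hA₂ h₂ O Y hp1 hp2, absH_twoSum₂_eq_sum hpar hA₁ hA₂ h₂ O Y hp1 hp2]
  set O₁ := O.toLeft
  set Y₁ := Y.toLeft
  set O₂ := O.toRight
  set Y₂ := Y.toRight
  -- the nine terms
  simp only [Finset.sum_product, Finset.sum_range_succ, Finset.sum_range_zero, zero_add]
  rw [wt_symm A₂ O₂ Y₂ 0 1, wt_symm A₂ O₂ Y₂ 0 2, wt_symm A₂ O₂ Y₂ 1 2]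
  -- the capacitated counts at the two rows
  have e00 := capH_zero_zero (A₁ := A₁) (p₁ := p₁) (p₂ := p₂) O₁ Y₁ i j
  have e00' := capH_zero_zero (A₁ := A₁) (p₁ := p₁) (p₂ := p₂) O₁ Y₁ (i + 1) (j - 1)
  have e10 := capH_one_zero_add (A₁ := A₁) (p₁ := p₁) (p₂ := p₂) O₁ Y₁ hY1 i j
  have e10' := capH_one_zero_add (A₁ := A₁) (p₁ := p₁) (p₂ := p₂) O₁ Y₁ hY1 (i + 1) (j - 1)
  have e11 := capH_one_one (A₁ := A₁) (p₁ := p₁) (p₂ := p₂) O₁ Y₁ i j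
  have e11' := capH_one_one (A₁ := A₁) (p₁ := p₁) (p₂ := p₂) O₁ Y₁ (i + 1) (j - 1)
  have e20 := capH_two_add_two hpar O₁ Y₁ hO1 hO2 hY1 hY2 i j
  have e20' := capH_two_add_two hpar O₁ Y₁ hO1 hO2 hY1 hY2 (i + 1) (j - 1)
  have e21 := capH_two_one_add (A₁ := A₁) (p₁ := p₁) (p₂ := p₂) O₁ Y₁ hY2 i j
  have e21' := capH_two_one_add (A₁ := A₁) (p₁ := p₁) (p₂ := p₂) O₁ Y₁ hY2 (i + 1) (j - 1)
  have e22 := capH_two_two (A₁ := A₁) (p₁ := p₁) (p₂ := p₂) O₁ Y₁ i j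
  have e22' := capH_two_two (A₁ := A₁) (p₁ := p₁) (p₂ := p₂) O₁ Y₁ (i + 1) (j - 1)
  have hR := wt_reimer hA₂ O₂ Y₂
  -- the absorption lemma over the reals
  have key := TwoSumAbsorb.absorb_step (wt A₂ O₂ Y₂ 0 0 : ℝ) (wt A₂ O₂ Y₂ 1 0) (wt A₂ O₂ Y₂ 1 1)
    (wt A₂ O₂ Y₂ 2 0) (wt A₂ O₂ Y₂ 2 1) (wt A₂ O₂ Y₂ 2 2) (Nat.cast_nonneg _) (Nat.cast_nonneg _)
    (Nat.cast_nonneg _) (Nat.cast_nonneg _) (Nat.cast_nonneg _) (Nat.cast_nonneg _)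
    (by have := hR; rw [wt_symm A₂ O₂ Y₂ 1 2] at this; exact_mod_cast this)
    (capH A₁ p₁ p₂ O₁ Y₁ i j 0 0 : ℝ) (capH A₁ p₁ p₂ O₁ Y₁ (i + 1) (j - 1) 0 0)
    (capH A₁ p₁ p₂ O₁ Y₁ i j 1 0 + capH A₁ p₁ p₂ O₁ Y₁ i j 0 1)
    (capH A₁ p₁ p₂ O₁ Y₁ (i + 1) (j - 1) 1 0 + capH A₁ p₁ p₂ O₁ Y₁ (i + 1) (j - 1) 0 1)
    (capH A₁ p₁ p₂ O₁ Y₁ i j 1 1) (capH A₁ p₁ p₂ O₁ Y₁ (i + 1) (j - 1) 1 1)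
    (capH A₁ p₁ p₂ O₁ Y₁ i j 2 1 + capH A₁ p₁ p₂ O₁ Y₁ i j 1 2)
    (capH A₁ p₁ p₂ O₁ Y₁ (i + 1) (j - 1) 2 1 + capH A₁ p₁ p₂ O₁ Y₁ (i + 1) (j - 1) 1 2)
    (capH A₁ p₁ p₂ O₁ Y₁ i j 2 2) (capH A₁ p₁ p₂ O₁ Y₁ (i + 1) (j - 1) 2 2)
    (capH A₁ p₁ p₂ O₁ Y₁ i j 2 0 + capH A₁ p₁ p₂ O₁ Y₁ i j 0 2)
    (capH A₁ p₁ p₂ O₁ Y₁ (i + 1) (j - 1) 2 0 + capH A₁ p₁ p₂ O₁ Y₁ (i + 1) (j - 1) 0 2)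
    (by rw [e00, e00']; exact_mod_cast hbase O₁ Y₁)
    (by rw [← Nat.cast_add, ← Nat.cast_add, e10, e10']; exact_mod_cast hbase O₁ (insert p₁ Y₁))
    (by rw [e11, e11']; exact_mod_cast hbase (insert p₁ O₁) Y₁)
    (by rw [← Nat.cast_add, ← Nat.cast_add, e21, e21']; exact_mod_cast hbase (insert p₁ O₁) (insert p₂ Y₁))
    (by rw [e22, e22']; exact_mod_cast hbase (insert p₁ (insert p₂ O₁)) Y₁)
    (by
      have h1 : (capH A₁ p₁ p₂ O₁ Y₁ i j 2 0 + capH A₁ p₁ p₂ O₁ Y₁ i j 0 2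
          + 2 * capH A₁ p₁ p₂ O₁ Y₁ i j 1 1 : ℝ) = absH A₁ O₁ (insert p₁ (insert p₂ Y₁)) i j := by
        exact_mod_cast e20
      have h1' : (capH A₁ p₁ p₂ O₁ Y₁ (i + 1) (j - 1) 2 0 + capH A₁ p₁ p₂ O₁ Y₁ (i + 1) (j - 1) 0 2
          + 2 * capH A₁ p₁ p₂ O₁ Y₁ (i + 1) (j - 1) 1 1 : ℝ)
          = absH A₁ O₁ (insert p₁ (insert p₂ Y₁)) (i + 1) (j - 1) := by
        exact_mod_cast e20'
      have h2 : (capH A₁ p₁ p₂ O₁ Y₁ i j 1 1 : ℝ) = absH A₁ (insert p₁ O₁) Y₁ i j := by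
        exact_mod_cast e11
      have h2' : (capH A₁ p₁ p₂ O₁ Y₁ (i + 1) (j - 1) 1 1 : ℝ)
          = absH A₁ (insert p₁ O₁) Y₁ (i + 1) (j - 1) := by exact_mod_cast e11'
      have hM : (absH A₁ O₁ (insert p₁ (insert p₂ Y₁)) i j
          + absH A₁ (insert p₁ O₁) Y₁ (i + 1) (j - 1) : ℝ)
          ≤ absH A₁ O₁ (insert p₁ (insert p₂ Y₁)) (i + 1) (j - 1) + absH A₁ (insert p₁ O₁) Y₁ i j := by
        exact_mod_cast hM₁
      linarith)
    (by
      have h1 : (capH A₁ p₁ p₂ O₁ Y₁ i j 2 0 + capH A₁ p₁ p₂ O₁ Y₁ i j 0 2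
          + 2 * capH A₁ p₁ p₂ O₁ Y₁ i j 1 1 : ℝ) = absH A₁ O₁ (insert p₁ (insert p₂ Y₁)) i j := by
        exact_mod_cast e20
      have h1' : (capH A₁ p₁ p₂ O₁ Y₁ (i + 1) (j - 1) 2 0 + capH A₁ p₁ p₂ O₁ Y₁ (i + 1) (j - 1) 0 2
          + 2 * capH A₁ p₁ p₂ O₁ Y₁ (i + 1) (j - 1) 1 1 : ℝ)
          = absH A₁ O₁ (insert p₁ (insert p₂ Y₁)) (i + 1) (j - 1) := by
        exact_mod_cast e20'
      have h2 : (capH A₁ p₁ p₂ O₁ Y₁ i j 1 1 : ℝ) = absH A₁ (insert p₁ O₁) Y₁ i j := by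
        exact_mod_cast e11
      have h2' : (capH A₁ p₁ p₂ O₁ Y₁ (i + 1) (j - 1) 1 1 : ℝ)
          = absH A₁ (insert p₁ O₁) Y₁ (i + 1) (j - 1) := by exact_mod_cast e11'
      have h3 : (capH A₁ p₁ p₂ O₁ Y₁ i j 2 1 + capH A₁ p₁ p₂ O₁ Y₁ i j 1 2 : ℝ)
          = absH A₁ (insert p₁ O₁) (insert p₂ Y₁) i j := by exact_mod_cast e21
      have h3' : (capH A₁ p₁ p₂ O₁ Y₁ (i + 1) (j - 1) 2 1 + capH A₁ p₁ p₂ O₁ Y₁ (i + 1) (j - 1) 1 2 : ℝ)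
          = absH A₁ (insert p₁ O₁) (insert p₂ Y₁) (i + 1) (j - 1) := by exact_mod_cast e21'
      have hM : (absH A₁ O₁ (insert p₁ (insert p₂ Y₁)) i j
          + absH A₁ (insert p₁ O₁) (insert p₂ Y₁) i j
          + 2 * absH A₁ (insert p₁ O₁) Y₁ (i + 1) (j - 1) : ℝ)
          ≤ absH A₁ O₁ (insert p₁ (insert p₂ Y₁)) (i + 1) (j - 1)
          + absH A₁ (insert p₁ O₁) (insert p₂ Y₁) (i + 1) (j - 1)
          + 2 * absH A₁ (insert p₁ O₁) Y₁ i j := by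
        exact_mod_cast hM₂
      linarith)
  rw [← Nat.cast_le (α := ℝ)]
  push_cast
  linarith [key]

end Closure

end StepZero

end Summit.Ventures.PercRepro2
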